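import Summits.QuantumFields.QCD.Theorems.QuarksAsStableActionStableActionBridgeSmitTransferForm
import Summits.QuantumFields.QCD.Theorems.QuarksAsStableActionStableActionBridgeSupertrace

/-!
# Lüscher's supertrace formula for the Wilson fermion determinant
(crux `QuarksAsStableAction.StableActionBridge`, item stmt-QuantumFields-9737, line `Sketch`;
registered stub `wilson_det_eq_supertrace_fermionSliceOp`, capstone B of the F3 dictionary)

For a four-torus `SU(3)` gauge field `U` on `(ℤ/L)⁴` (`L ≥ 1`) and one flavour of `r = 1` Wilson
quarks of bare mass `m > −1` in the fundamental representation, the Wilson fermion determinant is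
the Fock-space SUPERTRACE of the time-ordered product of Smit's fermionic transfer operators
`T̂_F(U_t) = (det A(U_t))² Γ(M_F(U_t))` (`fermionSliceOp`, Smit (6.91)) interleaved with the
Gauss-law gauge rotations `Γ(G_t)` (`fockGaugeAct`, Smit §4.6 (4.125)–(4.127)) by the temporal
links leaving slice `t`:

  `det D_W[U] = STr ∏_{t=0}^{L−1} T̂_F(U_t) Γ(G_t) = Σ_s (−1)^{#s} ⟨s| ∏_t T̂_F(U_t) Γ(G_t) |s⟩`.

Time is PERIODIC for the tree's `wilsonDirac`, whence the fermion-number twist `(−1)^F = (−1)^N̂`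
(Smit App. C (C.70): the Grassmann integral with periodic time computes `Tr[(−1)^N̂ ⋯]`, the
antiperiodic one the trace).

Assembly: capstone A (`wilson_det_eq_smit_transfer_form`) gives
`det D_W = (∏_t det A(U_t)²) · det (1 − ∏_t M_F(U_t) G_t)`; the finite product over `ZMod L` is
the ordered product over `List.range L`; `det (1 − X) = det (1 − reindex X)` along the enumeration
`sliceQuarkEquiv` of the slice quark modes, and `det (1 − Y) = Σ_s (−1)^{#s} Γ(Y)_{ss}`
(`Supertrace.det_one_sub_eq_supertrace_fockLift'`); finally `Γ ∘ reindex` is multiplicative and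
unital (`FockLiftPosDef.fockLift_mul`, `FockLiftPosDef.fockLift_one`,
`FermionSliceOpCovariance.reindex_mul_reindex`), so it passes through the ordered product, the
Dirac-sea scalars `det A(U_t)²` collecting in front.  Pure theorem file (no definitions).

References: M. Lüscher, Commun. Math. Phys. 54 (1977) 283 [Luscher1977, pp. 283–292]; J. Smit,
*Introduction to Quantum Fields on a Lattice*, §6.5 (6.87)–(6.91) and App. C (C.70)
[Smit2023, §6.5 (6.87)–(6.91), App. C (C.70)].
-/

noncomputable section

namespace Summit.QuantumFields.QCD.Cruxes.StableActionBridge.Sketch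

open MeasureTheory Matrix Literature.MathematicalPhysics.QuantumFieldTheory
  Literature.MathematicalPhysics.QuantumLattice
open Literature.Probability.LatticeModels (TorusSite)

namespace SupertraceTransferForm

/-! ### Finite products over `Finset.range L` / `ZMod L` as ordered `List.range L` products -/

/-- `∏_{i<n} f i` over `Finset.range n` is the ordered product over `List.range n`. [folklore] -/
theorem prod_range_eq_prod_map_range (f : ℕ → ℂ) :
    ∀ n : ℕ, ∏ i ∈ Finset.range n, f i = ((List.range n).map f).prod
  | 0 => by rw [Finset.prod_range_zero, List.range_zero, List.map_nil, List.prod_nil]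
  | n + 1 => by rw [Finset.prod_range_succ, List.prod_range_succ, prod_range_eq_prod_map_range f n]

/-- For `L ≥ 1`, a product over `ZMod L` is the ordered product over the residues of
`0, 1, …, L − 1`. [folklore] -/
theorem prod_univ_zmod_eq (L : ℕ) [NeZero L] (c : ZMod L → ℂ) :
    ∏ t : ZMod L, c t = ((List.range L).map fun i : ℕ => c i).prod := by
  obtain ⟨k, rfl⟩ : ∃ k, L = k + 1 := ⟨L - 1, (Nat.sub_one_add_one_eq_of_pos (NeZero.pos L)).symm⟩
  rw [← prod_range_eq_prod_map_range, ← Fin.prod_univ_eq_prod_range (fun i : ℕ => c i) (k + 1)]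
  exact Fintype.prod_congr _ _ fun i => congrArg c (ZMod.natCast_zmod_val (n := k + 1) i).symm

/-! ### `Γ ∘ reindex` through the ordered product, scalars in front -/

variable {m n : Type*} [Fintype m] [DecidableEq m] [LinearOrder n] [Fintype n]

/-- `∏_i (c_i Γ(reindex X_i)) Γ(reindex G_i) = (∏_i c_i) Γ(reindex ∏_i X_i G_i)` for ordered list
products: `Γ = fockLift` and `reindex e e` are multiplicative and unital. [folklore] -/
theorem prod_map_smul_fockLift_mul (e : m ≃ n) (c : ℕ → ℂ) (X G : ℕ → Matrix m m ℂ) :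
    ∀ l : List ℕ,
      (l.map fun i =>
          c i • fockLift (Matrix.reindex e e (X i)) * fockLift (Matrix.reindex e e (G i))).prod =
        (l.map c).prod • fockLift (Matrix.reindex e e (l.map fun i => X i * G i).prod)
  | [] => by
    rw [List.map_nil, List.prod_nil, List.map_nil, List.prod_nil, List.map_nil, List.prod_nil,
      one_smul, Matrix.reindex_apply, Matrix.submatrix_one_equiv, FockLiftPosDef.fockLift_one]
  | a :: l => by
    rw [List.map_cons, List.prod_cons, prod_map_smul_fockLift_mul e c X G l, List.map_cons,
      List.prod_cons, List.map_cons, List.prod_cons]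
    simp only [FermionSliceOpCovariance.reindex_mul_reindex, FockLiftPosDef.fockLift_mul,
      Matrix.smul_mul, Matrix.mul_smul, smul_smul, Matrix.mul_assoc]
    rw [mul_comm (c a)]

/-- **Abstract supertrace form.** For scalars `c_i`, one-particle matrices `X_i`, `G_i` and an
enumeration `e` of the modes by a linear order,
`(∏_{i<L} c_i) det (1 − ∏_{i<L} X_i G_i) = Σ_s (−1)^{#s} ⟨s|∏_{i<L} (c_i Γ(X'_i)) Γ(G'_i)|s⟩`,
`X' = reindex e e X`, `G' = reindex e e G` (`det (1 − Y) = STr Γ(Y)`, `Γ ∘ reindex`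
multiplicative). [folklore] -/
theorem supertrace_form (e : m ≃ n) (c : ℕ → ℂ) (X G : ℕ → Matrix m m ℂ) (L : ℕ) :
    ((List.range L).map c).prod * (1 - ((List.range L).map fun i => X i * G i).prod).det =
      ∑ s : Finset n, (-1 : ℂ) ^ s.card *
        ((List.range L).map fun i =>
            c i • fockLift (Matrix.reindex e e (X i)) * fockLift (Matrix.reindex e e (G i))).prod
          s s := by
  rw [prod_map_smul_fockLift_mul e c X G, ← SmitTransferForm.det_one_sub_reindex e,
    Supertrace.det_one_sub_eq_supertrace_fockLift', Finset.mul_sum]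
  refine Finset.sum_congr rfl fun s _ => ?_
  rw [Matrix.smul_apply, smul_eq_mul]
  ring

end SupertraceTransferForm

/-- **Capstone B of the F3 dictionary (stub `wilson_det_eq_supertrace_fermionSliceOp` of line
`Sketch`): Lüscher's supertrace formula.**  For an `SU(3)` gauge field `U` on the four-torus
`(ℤ/L)⁴`, one flavour of `r = 1` Wilson quarks of bare mass `m > −1` (fundamental representation),
`det D_W[U] = Σ_s (−1)^{#s} ⟨s| ∏_{t=0}^{L−1} T̂_F(U_t) Γ(G_t) |s⟩ = STr ∏_t T̂_F(U_t) Γ(G_t)`, with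
`U_t` the slice configuration `(x⃗, j) ↦ U((t, x⃗), j+1)`, `T̂_F(U_t) = fermionSliceOp U_t m` Smit's
fermionic transfer operator (6.91) and `Γ(G_t) = fockGaugeAct (y ↦ U((t, y), 0))` the Fock-space
gauge rotation by the temporal links (Gauss law); periodic time gives the `(−1)^F`-twisted trace.
[cite: Luscher1977, pp. 283–292] [cite: Smit2023, §6.5 (6.87)–(6.91), App. C (C.70)] -/
theorem wilson_det_eq_supertrace_fermionSliceOp : ∀ (L : ℕ) [NeZero L] (U : GaugeConfig 4 L (Matrix.specialUnitaryGroup (Fin 3) ℂ)) (m : ℝ), -1 < m → (wilsonDirac (fundamentalRep (Fin 3)) U m 1).det = ∑ s : Finset (SliceFermiIdx 1 L), (-1 : ℂ) ^ s.card * (((List.range L).map fun i : ℕ => fermionSliceOp (fun e : Edge 3 L => U ((Fin.cons (i : ZMod L) e.1 : TorusSite 4 L), e.2.succ)) (fun _ : Fin 1 => m) * fockGaugeAct (Nf := 1) (fun y : TorusSite 3 L => U ((Fin.cons (i : ZMod L) y : TorusSite 4 L), 0))).prod) s s := by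
  intro L _ U m hm
  -- capstone A: `det D_W = (∏_t det A(U_t)²) · det (1 − ∏_t M_F(U_t) G_t)`, the `ZMod L`-product
  -- rewritten as the ordered product over `List.range L`
  rw [wilson_det_eq_smit_transfer_form L U m hm, SupertraceTransferForm.prod_univ_zmod_eq]
  -- `det (1 − Y) = STr Γ(reindex Y)` and `Γ ∘ reindex` through the ordered product
  exact SupertraceTransferForm.supertrace_form (sliceQuarkEquiv (Nf := 1) (S := L))
    (fun i : ℕ => (sliceMassHop
      (fun e : Edge 3 L => U ((Fin.cons (i : ZMod L) e.1 : TorusSite 4 L), e.2.succ))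
      (fun _ : Fin 1 => m)).det ^ 2)
    (fun i : ℕ => fermionSliceMatrix
      (fun e : Edge 3 L => U ((Fin.cons (i : ZMod L) e.1 : TorusSite 4 L), e.2.succ))
      (fun _ : Fin 1 => m))
    (fun i : ℕ => sliceGaugeRot (Nf := 1)
      (fun y : TorusSite 3 L => U ((Fin.cons (i : ZMod L) y : TorusSite 4 L), 0)))
    L

end Summit.QuantumFields.QCD.Cruxes.StableActionBridge.Sketch

end
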